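import Mathlib.Analysis.SpecialFunctions.Trigonometric.DerivHyp
import Summits.AtomisticToContinuum.BoseEinsteinCondensation.Theses.BECStronglyRayleigh

/-!
# Route `BECStronglyRayleigh`, support `BondSymbolRayleigh` (stmt-AtomisticToContinuum-9679) — PROVED

For `t > 0` (`= Jτ`) and `κ > 0` (`= e^{−Vτ}`) the three Brändén–Rayleigh differences of the
two-site bond symbol,

* `Q₁(a,b) = cosh t sinh t (a² + b²) + (cosh² t + sinh² t − κ) a b`,
* `Q₂(a,b) = κ cosh t a² + (κ + 1) a b + cosh t b²`,
* `Q₃(a,b) = κ sinh t a² + (κ − 1) a b + sinh t b²`,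

are all nonnegative on `ℝ²` iff `e^{−2t} ≤ κ ≤ e^{2t}` ("bondwise kinetic domination",
`|V| ≤ 2J`).

Proof (elementary): a binary quadratic form `A a² + B a b + C b²` with `A > 0` is nonnegative iff
`B² ≤ 4AC` (`quadForm_nonneg_iff_discr`). Writing `c = cosh t`, `s = sinh t` (`c, s > 0`,
`c² − s² = 1`, `e^{±t} = c ± s`), each of the three discriminant slacks `4AC − B²` is identically
`−(κ − (c+s)²)(κ − (c−s)²)`, which is nonnegative iff `(c−s)² ≤ κ ≤ (c+s)²` because
`(c+s)² − (c−s)² = 4cs > 0`. So each of the three forms alone already pins the window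
`e^{−2t} ≤ κ ≤ e^{2t}`.

References: the criterion these forms instantiate is Brändén 2007, Thm 5.6 (tree:
`Literature.Combinatorics.StablePolynomials.Branden2007_multiAffine_rayleighDiff_nonneg_iff_realStable`);
the computation itself is folklore high-school algebra.
-/

namespace Summit.AtomisticToContinuum.BoseEinsteinCondensation.Theorems

/-- A real binary quadratic form `A a² + B a b + C b²` with positive leading coefficient `A` is
nonnegative on `ℝ²` iff its discriminant is nonpositive, `B² ≤ 4AC`. [folklore] -/
theorem bondSymbolRayleigh_quadForm_nonneg_iff {A B C : ℝ} (hA : 0 < A) :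
    (∀ a b : ℝ, 0 ≤ A * a ^ 2 + B * a * b + C * b ^ 2) ↔ B ^ 2 ≤ 4 * A * C := by
  constructor
  · intro h
    have h1 := h (-B) (2 * A)
    by_contra hlt
    push Not at hlt
    nlinarith [mul_pos hA (sub_pos.mpr hlt)]
  · intro h a b
    have h2 : 0 ≤ (2 * A * a + B * b) ^ 2 + (4 * A * C - B ^ 2) * b ^ 2 := by
      have := sq_nonneg (2 * A * a + B * b)
      have := mul_nonneg (sub_nonneg.mpr h) (sq_nonneg b)
      linarith
    by_contra hlt
    push Not at hlt
    have h3 : 0 < A * (-(A * a ^ 2 + B * a * b + C * b ^ 2)) := mul_pos hA (by linarith)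
    nlinarith [h2, h3]

/-- The window lemma: for `c, s > 0` the product slack `−(κ − (c+s)²)(κ − (c−s)²)` is nonnegative
iff `(c−s)² ≤ κ ≤ (c+s)²`. [folklore] -/
theorem bondSymbolRayleigh_window_iff {c s κ D : ℝ} (hc : 0 < c) (hs : 0 < s)
    (hD : D = -(κ - (c + s) ^ 2) * (κ - (c - s) ^ 2)) :
    0 ≤ D ↔ ((c - s) ^ 2 ≤ κ ∧ κ ≤ (c + s) ^ 2) := by
  subst hD
  have hcs : 0 < c * s := mul_pos hc hs
  constructor
  · intro h
    constructor
    · by_contra hlt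
      push Not at hlt
      nlinarith [mul_pos hcs (sub_pos.mpr hlt), sq_nonneg (κ - (c - s) ^ 2)]
    · by_contra hlt
      push Not at hlt
      nlinarith [mul_pos hcs (sub_pos.mpr hlt), sq_nonneg (κ - (c + s) ^ 2)]
  · rintro ⟨h1, h2⟩
    nlinarith [mul_nonneg (sub_nonneg.mpr h2) (sub_nonneg.mpr h1)]

/-- Algebraic core of `BondSymbolRayleigh`: for `c, s, κ > 0` with `c² − s² = 1`, the three
Brändén–Rayleigh bond forms are all nonnegative on `ℝ²` iff `(c−s)² ≤ κ ≤ (c+s)²` — each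
discriminant slack is `−(κ − (c+s)²)(κ − (c−s)²)`. [folklore] -/
theorem bondSymbolRayleigh_core {c s κ : ℝ} (hc : 0 < c) (hs : 0 < s) (hκ : 0 < κ)
    (hcs : c ^ 2 - s ^ 2 = 1) :
    ((∀ a b : ℝ, 0 ≤ c * s * (a ^ 2 + b ^ 2) + (c ^ 2 + s ^ 2 - κ) * a * b) ∧
      (∀ a b : ℝ, 0 ≤ κ * c * a ^ 2 + (κ + 1) * a * b + c * b ^ 2) ∧
      (∀ a b : ℝ, 0 ≤ κ * s * a ^ 2 + (κ - 1) * a * b + s * b ^ 2)) ↔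
    ((c - s) ^ 2 ≤ κ ∧ κ ≤ (c + s) ^ 2) := by
  have e1 : (∀ a b : ℝ, 0 ≤ c * s * (a ^ 2 + b ^ 2) + (c ^ 2 + s ^ 2 - κ) * a * b) ↔
      ((c - s) ^ 2 ≤ κ ∧ κ ≤ (c + s) ^ 2) := by
    have step : (∀ a b : ℝ, 0 ≤ c * s * (a ^ 2 + b ^ 2) + (c ^ 2 + s ^ 2 - κ) * a * b) ↔
        (∀ a b : ℝ, 0 ≤ (c * s) * a ^ 2 + (c ^ 2 + s ^ 2 - κ) * a * b + (c * s) * b ^ 2) :=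
      forall_congr' fun a => forall_congr' fun b => by
        constructor <;> intro h <;> linarith
    rw [step, bondSymbolRayleigh_quadForm_nonneg_iff (mul_pos hc hs), ← sub_nonneg]
    exact bondSymbolRayleigh_window_iff hc hs (by ring)
  have e2 : (∀ a b : ℝ, 0 ≤ κ * c * a ^ 2 + (κ + 1) * a * b + c * b ^ 2) ↔
      ((c - s) ^ 2 ≤ κ ∧ κ ≤ (c + s) ^ 2) := by
    rw [bondSymbolRayleigh_quadForm_nonneg_iff (mul_pos hκ hc), ← sub_nonneg]
    exact bondSymbolRayleigh_window_iff hc hs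
      (by linear_combination (2 * κ + c ^ 2 - s ^ 2 + 1) * hcs)
  have e3 : (∀ a b : ℝ, 0 ≤ κ * s * a ^ 2 + (κ - 1) * a * b + s * b ^ 2) ↔
      ((c - s) ^ 2 ≤ κ ∧ κ ≤ (c + s) ^ 2) := by
    rw [bondSymbolRayleigh_quadForm_nonneg_iff (mul_pos hκ hs), ← sub_nonneg]
    exact bondSymbolRayleigh_window_iff hc hs
      (by linear_combination (c ^ 2 - s ^ 2 + 1 - 2 * κ) * hcs)
  rw [e1, e2, e3]
  tauto

/-- **`BondSymbolRayleigh`** (route `BECStronglyRayleigh`, support item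
stmt-AtomisticToContinuum-9679): for `t > 0` and `κ > 0` the three Brändén–Rayleigh differences of
the bond symbol are all nonnegative on `ℝ²` iff `e^{−2t} ≤ κ ≤ e^{2t}`. With `c = cosh t`,
`s = sinh t`: `e^{2t} = (c+s)²`, `e^{−2t} = (c−s)²`, `c² − s² = 1`, and `bondSymbolRayleigh_core`.
[folklore] -/
theorem bondSymbolRayleigh_proof :
    Summit.AtomisticToContinuum.BoseEinsteinCondensation.Theses.BECStronglyRayleigh.BondSymbolRayleigh := by
  unfold Theses.BECStronglyRayleigh.BondSymbolRayleigh
  intro t κ ht hκ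
  have hP : Real.exp (2 * t) = (Real.cosh t + Real.sinh t) ^ 2 := by
    rw [Real.cosh_add_sinh, two_mul, Real.exp_add, sq]
  have hQ : Real.exp (-(2 * t)) = (Real.cosh t - Real.sinh t) ^ 2 := by
    rw [Real.cosh_sub_sinh, two_mul, neg_add, Real.exp_add, sq]
  rw [hP, hQ]
  exact bondSymbolRayleigh_core (Real.cosh_pos t) (Real.sinh_pos_iff.mpr ht) hκ
    (Real.cosh_sq_sub_sinh_sq t)

end Summit.AtomisticToContinuum.BoseEinsteinCondensation.Theorems
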